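import Mathlib
import HarnessLib
import Summits.HubbardSuperconductivity.HubbardSuperconductivity.Theorems.KLProgrammeKLRegimeTwoLegCurvatureDefs
import Summits.HubbardSuperconductivity.HubbardSuperconductivity.Theorems.KLProgrammeKLRegimeEngineFrameShiftSymbolMomentsFlow

/-!
# (C1) JACKSON REMAINDER AT DEEP SCALES — the SCALE-COVARIANCE ARITHMETIC («(C)-JETBOX-DEEP», pen plan g19 KL l.3470 (ii))

Cell `gate-hubbard-kl`, seat hubbard-kl-k3c3-p3 (g11), `--supports stmt-HubbardSuperconductivity-20437` (stub (C) `stub_twoLeg_curvature` of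
`KLRegimeEngineV17F2`).  Companion memo: `HOME/hubbard-kl-k3c3-p3/C1-JETBOX-DEEP.md` (evidence on 20437).

The (C1) door (k3c3-p1, `…CountertermJacksonRemainderWeighted` / `…CertDefs`: `CutoffDefectTable.bound`) bounds the `k`-jet of the Jackson remainder
`J = ν_n(K_n) − (klFlowPiece n)∘k_F^{K_{n+1}}` of the scale-`n` reading, at Jackson degree `d = klFlowDeg n = 2⁷·4ⁿ`, by a LINEAR FORM in the reading's
jet sizes `a_l(n) ≤ curveJetBar c c' U l n = (c_l + c′_l|U|)·uPow l U·4^{(l−2)n}` with kernel-moment coefficients; the (C) budget compares it with the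
NEXT scale's allowance `curveJetBar c c' U k (n+1)`.  Its CERTIFIED instances (`klC1TableF512/2048`) cover the shallow reading scales `n+1 ≤ 3` only.
This file is the bookkeeping that makes the DEEP-scale (`n+1 ≥ 4`, up to `nScales β + 1`) analytic bound `n`-UNIFORM — pure arithmetic of the
registered currencies, no analysis:

* §1 degree schedule: `(klFlowDeg n : ℝ) = 2⁷·4ⁿ`, `1/(d+1)^p ≤ 1/(2^{7p}·4^{pn})`;
* §2 the bar's scale law `bar(k, n+1) = 4^{k−2}·bar(k, n)`;
* §3 **THE TERM LAW** `jacksonScale_term_law`: a door term `a_l(n)·X/(d+1)^p` (order-`l` jet size × kernel moment of homogeneity `p` in `1/d`) is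
  `≤ κ·4^{(l−k−p)·n}·bar(k, n+1)` as soon as `(c_l + c′_l|U|)·X ≤ κ·2^{7p}·4^{k−2}·(c_k + c′_k|U|)` — an `n`-FREE condition on the tables; hence
  the RATE term (`l = k+1`, `p = 1`: the transport moment `Td ≍ 1/d`) is an `n`-free FRACTION `κ` of the next bar (`jacksonScale_rate_le`), the
  same-order rows (`l = k`, `p = 0`: `Tu`, `N0`, the no-rate top row) cost `X/4^{k−2}` (`jacksonScale_same_le`), every lower-order or higher-moment
  row DECAYS like `4^{(l−k−p)n}`; the VALUE direction (`k = 0`, whose law is `|U|·16^{−n}`) gains a factor `|U|` (`jacksonScale_value_le`);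
* §4 frame-growth terms: a term carrying a flow-frame size `A_j(n+1) ≍ Gfr_j·U²·4^{(j−2)(n+1)}` (growing like `4ⁿ`, `16ⁿ` for `j = 3, 4`) obeys
  `a_l(n)·(G·U²·4^{(j−2)(n+1)})·X/(d+1)^p ≤ κ·U²·4^{(l+j−k−p−2)n}·bar(k, n+1)` (`jacksonScale_frame_term_law`) — the `16ⁿ` of `A₄` never binds
  (worst near row `l = 1, j = 4, p = 1, k = 4`: relative size `U²·16^{−n}`);
* §5 the flow frame's sizes in closed form from the history `FlowPieceJetsAt … m` (`m < n`):
  `‖Dʲ evalM K_n‖ ≤ (16/15)Gfr₀|U|, (4/3)Gfr₁U², n·Gfr₂U², (Gfr₃/3)U²4ⁿ, (Gfr₄/15)U²16ⁿ` (`j = 0…4`), and `≤ Gfr₂·c/log 4` at `j = 2` in the regime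
  `IsKLRegime U c (−n)` (the one cumulative FLAT row, small by `c` not by `U`).

Nothing here asserts stub (C); arithmetic of `curveJetBar`, `klFlowDeg`, `FlowPieceJetsAt` only.
-/

noncomputable section

namespace Summit.HubbardSuperconductivity.HubbardSuperconductivity.Theorems.KLRegimeSplit

set_option linter.dupNamespace false -- summit = problem name (single-conjunct summit), D-0017

open Finset Literature.MathematicalPhysics.QuantumLattice Literature.Probability.LatticeModels
open Summit.HubbardSuperconductivity.HubbardSuperconductivity.Theorems.EngineV8
open Summit.HubbardSuperconductivity.HubbardSuperconductivity.Theorems.DispersionFlow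

/-! ## §1 Degree-schedule arithmetic -/

/-- `klFlowDeg n = 2⁷·4ⁿ` as a real number. -/
theorem klFlowDeg_cast (n : ℕ) : ((klFlowDeg n : ℕ) : ℝ) = 2 ^ 7 * 4 ^ n := by
  unfold klFlowDeg; push_cast; ring

/-- `2⁷·4ⁿ ≤ klFlowDeg n + 1`. -/
theorem two_pow_mul_four_pow_le_klFlowDeg_succ (n : ℕ) : (2 : ℝ) ^ 7 * 4 ^ n ≤ ((klFlowDeg n : ℕ) : ℝ) + 1 := by
  rw [klFlowDeg_cast]; linarith

/-- `(2⁷·4ⁿ)^p = 2^{7p}·4^{pn} ≤ (klFlowDeg n + 1)^p`. -/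
theorem two_pow_mul_four_pow_pow_le_klFlowDeg_succ_pow (n p : ℕ) :
    (2 : ℝ) ^ (7 * p) * (4 : ℝ) ^ (p * n) ≤ (((klFlowDeg n : ℕ) : ℝ) + 1) ^ p := by
  have h := pow_le_pow_left₀ (by positivity) (two_pow_mul_four_pow_le_klFlowDeg_succ n) p
  rwa [mul_pow, ← pow_mul, ← pow_mul, mul_comm n p] at h

/-- **`X/(klFlowDeg n + 1)^p ≤ X/(2^{7p}·4^{pn})`** for `X ≥ 0` — a kernel moment homogeneous of degree `p` in `1/d` inherits the clean power. -/
theorem div_klFlowDeg_succ_pow_le {X : ℝ} (hX : 0 ≤ X) (n p : ℕ) :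
    X / (((klFlowDeg n : ℕ) : ℝ) + 1) ^ p ≤ X / ((2 : ℝ) ^ (7 * p) * (4 : ℝ) ^ (p * n)) :=
  div_le_div_of_nonneg_left hX (by positivity) (two_pow_mul_four_pow_pow_le_klFlowDeg_succ_pow n p)

/-! ## §2 The bar's scale law -/

/-- For `k ≥ 1` the bar is `(c k + c' k·|U|)·U²·4^{(k−2)n}`. -/
theorem curveJetBar_of_one_le {k : ℕ} (hk : 1 ≤ k) (c c' : ℕ → ℝ) (U : ℝ) (n : ℕ) :
    curveJetBar c c' U k n = (c k + c' k * |U|) * U ^ 2 * (4 : ℝ) ^ (((k : ℤ) - 2) * n) := by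
  unfold curveJetBar uPow; rw [if_neg (by omega)]

/-- At `k = 0` the bar is `(c 0 + c' 0·|U|)·|U|·4^{−2n}`. -/
theorem curveJetBar_zero_left (c c' : ℕ → ℝ) (U : ℝ) (n : ℕ) :
    curveJetBar c c' U 0 n = (c 0 + c' 0 * |U|) * |U| * (4 : ℝ) ^ ((-2 : ℤ) * n) := by
  unfold curveJetBar uPow; simp

/-- **Scale law of the bar**: `bar(k, n+1) = bar(k, n)·4^{k−2}` — decaying for `k ≤ 1`, flat at `k = 2`, growing `4×`/`16×` at `k = 3, 4`. -/
theorem curveJetBar_succ_right (c c' : ℕ → ℝ) (U : ℝ) (k n : ℕ) :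
    curveJetBar c c' U k (n + 1) = curveJetBar c c' U k n * (4 : ℝ) ^ ((k : ℤ) - 2) := by
  unfold curveJetBar
  have h4 : (4 : ℝ) ≠ 0 := by norm_num
  push_cast
  rw [mul_add, mul_one, zpow_add₀ h4]; ring

/-! ## §3 THE TERM LAW (orders `k, l ≥ 1`) -/

/-- Exponent bookkeeping: `4^{k−2}·4^{(l−2)n} = 4^{(l−k−p)n}·4^{(k−2)(n+1)}·4^{pn}`. -/
private theorem four_zpow_bookkeeping (k l p n : ℕ) :
    (4 : ℝ) ^ ((k : ℤ) - 2) * (4 : ℝ) ^ (((l : ℤ) - 2) * n) =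
      (4 : ℝ) ^ (((l : ℤ) - k - p) * n) * (4 : ℝ) ^ (((k : ℤ) - 2) * ((n + 1 : ℕ) : ℤ)) * (4 : ℝ) ^ (p * n) := by
  have h4 : (4 : ℝ) ≠ 0 := by norm_num
  rw [← zpow_natCast (4 : ℝ) (p * n), ← zpow_add₀ h4, ← zpow_add₀ h4, ← zpow_add₀ h4]
  congr 1; push_cast; ring

/-- **THE TERM LAW.**  A (C1)-door term of the shape `a_l(n)·X/(d+1)^p` — order-`l` jet size of the scale-`n` reading (`a_l(n) ≤ curveJetBar c c' U l n`)
times a kernel moment bounded by `X/(d+1)^p`, `d = klFlowDeg n` — is at most `κ·4^{(l−k−p)n}` times the NEXT scale's order-`k` bar, under the `n`-FREE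
table condition `(c_l + c′_l|U|)·X ≤ κ·2^{7p}·4^{k−2}·(c_k + c′_k|U|)`.  (`k, l ≥ 1`; for `l − k − p ≤ 0` the factor `4^{(l−k−p)n} ≤ 1`.) -/
theorem jacksonScale_term_law {c c' : ℕ → ℝ} {U X κ : ℝ} {k l p n : ℕ} (hk : 1 ≤ k) (hl : 1 ≤ l)
    (hcl : 0 ≤ c l + c' l * |U|) (hX : 0 ≤ X)
    (hκ : (c l + c' l * |U|) * X ≤ κ * 2 ^ (7 * p) * (4 : ℝ) ^ ((k : ℤ) - 2) * (c k + c' k * |U|)) :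
    curveJetBar c c' U l n * (X / (((klFlowDeg n : ℕ) : ℝ) + 1) ^ p) ≤
      κ * (4 : ℝ) ^ (((l : ℤ) - k - p) * n) * curveJetBar c c' U k (n + 1) := by
  rw [curveJetBar_of_one_le hl, curveJetBar_of_one_le hk]
  have h4 : (4 : ℝ) ≠ 0 := by norm_num
  have h2p : (0 : ℝ) < 2 ^ (7 * p) := by positivity
  have h4p : (0 : ℝ) < (4 : ℝ) ^ (p * n) := by positivity
  have hW : 0 ≤ U ^ 2 * (4 : ℝ) ^ (((l : ℤ) - 2) * n) / ((2 : ℝ) ^ (7 * p) * (4 : ℝ) ^ (p * n)) := by positivity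
  calc (c l + c' l * |U|) * U ^ 2 * (4 : ℝ) ^ (((l : ℤ) - 2) * n) * (X / (((klFlowDeg n : ℕ) : ℝ) + 1) ^ p)
      ≤ (c l + c' l * |U|) * U ^ 2 * (4 : ℝ) ^ (((l : ℤ) - 2) * n) * (X / ((2 : ℝ) ^ (7 * p) * (4 : ℝ) ^ (p * n))) :=
        mul_le_mul_of_nonneg_left (div_klFlowDeg_succ_pow_le hX n p) (by positivity)
    _ = (c l + c' l * |U|) * X * (U ^ 2 * (4 : ℝ) ^ (((l : ℤ) - 2) * n) / ((2 : ℝ) ^ (7 * p) * (4 : ℝ) ^ (p * n))) := by ring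
    _ ≤ κ * 2 ^ (7 * p) * (4 : ℝ) ^ ((k : ℤ) - 2) * (c k + c' k * |U|) *
          (U ^ 2 * (4 : ℝ) ^ (((l : ℤ) - 2) * n) / ((2 : ℝ) ^ (7 * p) * (4 : ℝ) ^ (p * n))) :=
        mul_le_mul_of_nonneg_right hκ hW
    _ = κ * (4 : ℝ) ^ (((l : ℤ) - k - p) * n) * ((c k + c' k * |U|) * U ^ 2 * (4 : ℝ) ^ (((k : ℤ) - 2) * ((n + 1 : ℕ) : ℤ))) := by
        rw [div_eq_mul_inv, mul_inv]
        have hb := four_zpow_bookkeeping k l p n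
        calc κ * 2 ^ (7 * p) * (4 : ℝ) ^ ((k : ℤ) - 2) * (c k + c' k * |U|) *
              (U ^ 2 * (4 : ℝ) ^ (((l : ℤ) - 2) * n) * ((2 ^ (7 * p))⁻¹ * ((4 : ℝ) ^ (p * n))⁻¹))
            = κ * (c k + c' k * |U|) * U ^ 2 * (2 ^ (7 * p) * (2 ^ (7 * p))⁻¹) *
                (((4 : ℝ) ^ ((k : ℤ) - 2) * (4 : ℝ) ^ (((l : ℤ) - 2) * n)) * ((4 : ℝ) ^ (p * n))⁻¹) := by ring
          _ = κ * (c k + c' k * |U|) * U ^ 2 * 1 *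
                ((4 : ℝ) ^ (((l : ℤ) - k - p) * n) * (4 : ℝ) ^ (((k : ℤ) - 2) * ((n + 1 : ℕ) : ℤ)) *
                  ((4 : ℝ) ^ (p * n) * ((4 : ℝ) ^ (p * n))⁻¹)) := by rw [mul_inv_cancel₀ h2p.ne', hb]; ring
          _ = κ * (4 : ℝ) ^ (((l : ℤ) - k - p) * n) * ((c k + c' k * |U|) * U ^ 2 * (4 : ℝ) ^ (((k : ℤ) - 2) * ((n + 1 : ℕ) : ℤ))) := by
                rw [mul_inv_cancel₀ h4p.ne']; ring

/-- **The RATE row is an `n`-free fraction of the next bar** (`l = k+1`, `p = 1`): `a_{k+1}(n)·X/(d+1) ≤ κ·bar(k, n+1)` whenever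
`(c_{k+1} + c′_{k+1}|U|)·X ≤ κ·2⁷·4^{k−2}·(c_k + c′_k|U|)`.  With `X = (π√3/2)/u_min` (second moment of the 2-D Jackson kernel `σ_d ≤ π√3/(2(d+1))`,
`…CountertermJacksonSharpMoments`, over the minimal Fermi radius) this is the deep-scale transport coupling `κ = (c_{k+1}/c_k)·(π√3/2)/(2⁷·4^{k−2}·u_min)`. -/
theorem jacksonScale_rate_le {c c' : ℕ → ℝ} {U X κ : ℝ} {k n : ℕ} (hk : 1 ≤ k)
    (hcl : 0 ≤ c (k + 1) + c' (k + 1) * |U|) (hX : 0 ≤ X)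
    (hκ : (c (k + 1) + c' (k + 1) * |U|) * X ≤ κ * 2 ^ 7 * (4 : ℝ) ^ ((k : ℤ) - 2) * (c k + c' k * |U|)) :
    curveJetBar c c' U (k + 1) n * (X / (((klFlowDeg n : ℕ) : ℝ) + 1)) ≤ κ * curveJetBar c c' U k (n + 1) := by
  have h := jacksonScale_term_law (p := 1) (n := n) hk (by omega : 1 ≤ k + 1) hcl hX (by simpa using hκ)
  have he : ((((k + 1 : ℕ) : ℤ) - k - (1 : ℕ)) * n : ℤ) = 0 := by push_cast; ring
  rw [pow_one, he, zpow_zero, mul_one] at h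
  exact h

/-- **Same-order rows** (`l = k`, `p = 0`: the `Tu`, `N0` and no-rate top-order rows): `a_k(n)·X ≤ κ·bar(k, n+1)` whenever `X ≤ κ·4^{k−2}`
(no table ratio: the bar grows by `4^{k−2}` per scale, so an `O(1)` same-order constant is a fraction `X/4^{k−2}` of the next bar). -/
theorem jacksonScale_same_le {c c' : ℕ → ℝ} {U X κ : ℝ} {k n : ℕ} (hk : 1 ≤ k) (hck : 0 ≤ c k + c' k * |U|)
    (hX : X ≤ κ * (4 : ℝ) ^ ((k : ℤ) - 2)) :
    curveJetBar c c' U k n * X ≤ κ * curveJetBar c c' U k (n + 1) := by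
  rw [curveJetBar_succ_right]
  have hb : 0 ≤ curveJetBar c c' U k n := by
    rw [curveJetBar_of_one_le hk]; positivity
  calc curveJetBar c c' U k n * X ≤ curveJetBar c c' U k n * (κ * (4 : ℝ) ^ ((k : ℤ) - 2)) := mul_le_mul_of_nonneg_left hX hb
    _ = κ * (curveJetBar c c' U k n * (4 : ℝ) ^ ((k : ℤ) - 2)) := by ring

/-- **Lower-order / higher-moment rows DECAY**: under the term law's condition with `l ≤ k + p` (integer exponent `l − k − p ≤ 0`) the bound is
`≤ κ·bar(k, n+1)` at EVERY `n`, and for `l < k + p` it is `≤ κ·4^{−n}·bar(k, n+1)`. -/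
theorem jacksonScale_term_le_of_le {c c' : ℕ → ℝ} {U X κ : ℝ} {k l p n : ℕ} (hk : 1 ≤ k) (hl : 1 ≤ l) (hlk : l ≤ k + p)
    (hcl : 0 ≤ c l + c' l * |U|) (hck : 0 ≤ c k + c' k * |U|) (hX : 0 ≤ X) (hκ0 : 0 ≤ κ)
    (hκ : (c l + c' l * |U|) * X ≤ κ * 2 ^ (7 * p) * (4 : ℝ) ^ ((k : ℤ) - 2) * (c k + c' k * |U|)) :
    curveJetBar c c' U l n * (X / (((klFlowDeg n : ℕ) : ℝ) + 1) ^ p) ≤ κ * curveJetBar c c' U k (n + 1) := by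
  refine (jacksonScale_term_law hk hl hcl hX hκ).trans ?_
  have hb : 0 ≤ curveJetBar c c' U k (n + 1) := by rw [curveJetBar_of_one_le hk]; positivity
  have hz : (4 : ℝ) ^ (((l : ℤ) - k - p) * n) ≤ 1 :=
    zpow_le_one_of_nonpos₀ (by norm_num) (mul_nonpos_of_nonpos_of_nonneg (by omega) (by positivity))
  calc κ * (4 : ℝ) ^ (((l : ℤ) - k - p) * n) * curveJetBar c c' U k (n + 1)
      ≤ κ * 1 * curveJetBar c c' U k (n + 1) := by gcongr
    _ = κ * curveJetBar c c' U k (n + 1) := by ring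

/-- The strict case `l < k + p`: `≤ κ·4^{−n}·bar(k, n+1)`. -/
theorem jacksonScale_term_le_of_lt {c c' : ℕ → ℝ} {U X κ : ℝ} {k l p n : ℕ} (hk : 1 ≤ k) (hl : 1 ≤ l) (hlk : l < k + p)
    (hcl : 0 ≤ c l + c' l * |U|) (hck : 0 ≤ c k + c' k * |U|) (hX : 0 ≤ X) (hκ0 : 0 ≤ κ)
    (hκ : (c l + c' l * |U|) * X ≤ κ * 2 ^ (7 * p) * (4 : ℝ) ^ ((k : ℤ) - 2) * (c k + c' k * |U|)) :
    curveJetBar c c' U l n * (X / (((klFlowDeg n : ℕ) : ℝ) + 1) ^ p) ≤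
      κ * (4 : ℝ) ^ (-(n : ℤ)) * curveJetBar c c' U k (n + 1) := by
  refine (jacksonScale_term_law hk hl hcl hX hκ).trans ?_
  have hb : 0 ≤ curveJetBar c c' U k (n + 1) := by rw [curveJetBar_of_one_le hk]; positivity
  have hz : (4 : ℝ) ^ (((l : ℤ) - k - p) * n) ≤ (4 : ℝ) ^ (-(n : ℤ)) :=
    zpow_le_zpow_right₀ (by norm_num) (by nlinarith [(by omega : ((l : ℤ) - k - p) ≤ -1), (by positivity : (0 : ℤ) ≤ n)])
  gcongr

/-! ## §3b The VALUE direction (`k = 0`: law `|U|·16^{−n}`) gains a factor `|U|` -/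

/-- **The value row's rate term** (`l = 1`, `p = 1` against the `k = 0` bar): `a_1(n)·X/(d+1) ≤ κ·|U|·bar(0, n+1)` whenever
`16·(c_1 + c′_1|U|)·X ≤ κ·2⁷·(c_0 + c′_0|U|)` — the (C1) share of the VALUE clause is `O(|U|)` (the value bar is `|U|`-sized, the jets `U²`-sized). -/
theorem jacksonScale_value_le {c c' : ℕ → ℝ} {U X κ : ℝ} {n : ℕ} (hc1 : 0 ≤ c 1 + c' 1 * |U|) (hX : 0 ≤ X)
    (hκ : 16 * (c 1 + c' 1 * |U|) * X ≤ κ * 2 ^ 7 * (c 0 + c' 0 * |U|)) :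
    curveJetBar c c' U 1 n * (X / (((klFlowDeg n : ℕ) : ℝ) + 1)) ≤ κ * |U| * curveJetBar c c' U 0 (n + 1) := by
  rw [curveJetBar_of_one_le le_rfl, curveJetBar_zero_left]
  have h4 : (4 : ℝ) ≠ 0 := by norm_num
  have hd := div_klFlowDeg_succ_pow_le hX n 1
  rw [pow_one, mul_one, one_mul] at hd
  -- exponents: `4^{(1−2)n}/4ⁿ = 16·4^{−2(n+1)}`
  have hz : (4 : ℝ) ^ ((((1 : ℕ) : ℤ) - 2) * n) * ((4 : ℝ) ^ n)⁻¹ = 16 * (4 : ℝ) ^ ((-2 : ℤ) * ((n + 1 : ℕ) : ℤ)) := by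
    rw [← zpow_natCast (4 : ℝ) n, ← zpow_neg, ← zpow_add₀ h4, show (16 : ℝ) = (4 : ℝ) ^ (2 : ℤ) by norm_num, ← zpow_add₀ h4]
    congr 1; push_cast; ring
  have hU2 : U ^ 2 = |U| * |U| := by rw [← sq_abs]; ring
  calc (c 1 + c' 1 * |U|) * U ^ 2 * (4 : ℝ) ^ ((((1 : ℕ) : ℤ) - 2) * n) * (X / (((klFlowDeg n : ℕ) : ℝ) + 1))
      ≤ (c 1 + c' 1 * |U|) * U ^ 2 * (4 : ℝ) ^ ((((1 : ℕ) : ℤ) - 2) * n) * (X / (2 ^ 7 * 4 ^ n)) :=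
        mul_le_mul_of_nonneg_left hd (by positivity)
    _ = (16 * (c 1 + c' 1 * |U|) * X) * (U ^ 2 * ((4 : ℝ) ^ ((((1 : ℕ) : ℤ) - 2) * n) * ((4 : ℝ) ^ n)⁻¹)) / (16 * 2 ^ 7) := by
        field_simp
    _ ≤ (κ * 2 ^ 7 * (c 0 + c' 0 * |U|)) * (U ^ 2 * ((4 : ℝ) ^ ((((1 : ℕ) : ℤ) - 2) * n) * ((4 : ℝ) ^ n)⁻¹)) / (16 * 2 ^ 7) := by
        gcongr
    _ = κ * |U| * ((c 0 + c' 0 * |U|) * |U| * (4 : ℝ) ^ ((-2 : ℤ) * ((n + 1 : ℕ) : ℤ))) := by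
        rw [hz, hU2]; field_simp

/-! ## §4 Frame-growth terms (a flow-frame size `A_j(n+1) ≍ G·U²·4^{(j−2)(n+1)}` inside a door term) -/

/-- Exponent bookkeeping for the frame terms: `4^{k−j}·4^{(l−2)n}·4^{(j−2)(n+1)} = 4^{(l+j−k−p−2)n}·4^{(k−2)(n+1)}·4^{pn}`. -/
private theorem four_zpow_bookkeeping_frame (k l j p n : ℕ) :
    (4 : ℝ) ^ ((k : ℤ) - j) * (4 : ℝ) ^ (((l : ℤ) - 2) * n) * (4 : ℝ) ^ (((j : ℤ) - 2) * ((n + 1 : ℕ) : ℤ)) =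
      (4 : ℝ) ^ (((l : ℤ) + j - k - p - 2) * n) * (4 : ℝ) ^ (((k : ℤ) - 2) * ((n + 1 : ℕ) : ℤ)) * (4 : ℝ) ^ (p * n) := by
  have h4 : (4 : ℝ) ≠ 0 := by norm_num
  rw [← zpow_natCast (4 : ℝ) (p * n), ← zpow_add₀ h4, ← zpow_add₀ h4, ← zpow_add₀ h4, ← zpow_add₀ h4]
  congr 1; push_cast; ring

/-- **THE FRAME TERM LAW.**  A door term `a_l(n)·(G·U²·4^{(j−2)(n+1)})·X/(d+1)^p` — the reading's order-`l` jet size times a flow-frame size of order `j`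
at the reading frame `K_{n+1}` (closed form `G·U²·4^{(j−2)(n+1)}`, §5) times a kernel moment of homogeneity `p` — is at most
`κ·U²·4^{(l+j−k−p−2)n}·bar(k, n+1)` under the `n`-FREE condition `(c_l + c′_l|U|)·G·X ≤ κ·2^{7p}·4^{k−j}·(c_k + c′_k|U|)`.
Worst near-transport row (`l = 1`, `j = 4`, `p = 1`, `k = 4`): exponent `−2n` — the `16ⁿ` growth of `‖D⁴K_{n+1}‖` is harmless. -/
theorem jacksonScale_frame_term_law {c c' : ℕ → ℝ} {U G X κ : ℝ} {k l j p n : ℕ} (hk : 1 ≤ k) (hl : 1 ≤ l)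
    (hcl : 0 ≤ c l + c' l * |U|) (hG : 0 ≤ G) (hX : 0 ≤ X)
    (hκ : (c l + c' l * |U|) * G * X ≤ κ * 2 ^ (7 * p) * (4 : ℝ) ^ ((k : ℤ) - j) * (c k + c' k * |U|)) :
    curveJetBar c c' U l n * (G * U ^ 2 * (4 : ℝ) ^ (((j : ℤ) - 2) * ((n + 1 : ℕ) : ℤ))) * (X / (((klFlowDeg n : ℕ) : ℝ) + 1) ^ p) ≤
      κ * U ^ 2 * (4 : ℝ) ^ (((l : ℤ) + j - k - p - 2) * n) * curveJetBar c c' U k (n + 1) := by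
  rw [curveJetBar_of_one_le hl, curveJetBar_of_one_le hk]
  have h4 : (4 : ℝ) ≠ 0 := by norm_num
  have h2p : (0 : ℝ) < 2 ^ (7 * p) := by positivity
  have h4p : (0 : ℝ) < (4 : ℝ) ^ (p * n) := by positivity
  have hW : 0 ≤ U ^ 2 * U ^ 2 * (4 : ℝ) ^ (((l : ℤ) - 2) * n) * (4 : ℝ) ^ (((j : ℤ) - 2) * ((n + 1 : ℕ) : ℤ)) /
      ((2 : ℝ) ^ (7 * p) * (4 : ℝ) ^ (p * n)) := by positivity
  calc (c l + c' l * |U|) * U ^ 2 * (4 : ℝ) ^ (((l : ℤ) - 2) * n) * (G * U ^ 2 * (4 : ℝ) ^ (((j : ℤ) - 2) * ((n + 1 : ℕ) : ℤ))) *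
        (X / (((klFlowDeg n : ℕ) : ℝ) + 1) ^ p)
      ≤ (c l + c' l * |U|) * U ^ 2 * (4 : ℝ) ^ (((l : ℤ) - 2) * n) * (G * U ^ 2 * (4 : ℝ) ^ (((j : ℤ) - 2) * ((n + 1 : ℕ) : ℤ))) *
        (X / ((2 : ℝ) ^ (7 * p) * (4 : ℝ) ^ (p * n))) :=
        mul_le_mul_of_nonneg_left (div_klFlowDeg_succ_pow_le hX n p) (by positivity)
    _ = (c l + c' l * |U|) * G * X * (U ^ 2 * U ^ 2 * (4 : ℝ) ^ (((l : ℤ) - 2) * n) * (4 : ℝ) ^ (((j : ℤ) - 2) * ((n + 1 : ℕ) : ℤ)) /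
          ((2 : ℝ) ^ (7 * p) * (4 : ℝ) ^ (p * n))) := by ring
    _ ≤ κ * 2 ^ (7 * p) * (4 : ℝ) ^ ((k : ℤ) - j) * (c k + c' k * |U|) *
          (U ^ 2 * U ^ 2 * (4 : ℝ) ^ (((l : ℤ) - 2) * n) * (4 : ℝ) ^ (((j : ℤ) - 2) * ((n + 1 : ℕ) : ℤ)) /
            ((2 : ℝ) ^ (7 * p) * (4 : ℝ) ^ (p * n))) := mul_le_mul_of_nonneg_right hκ hW
    _ = κ * U ^ 2 * (4 : ℝ) ^ (((l : ℤ) + j - k - p - 2) * n) *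
          ((c k + c' k * |U|) * U ^ 2 * (4 : ℝ) ^ (((k : ℤ) - 2) * ((n + 1 : ℕ) : ℤ))) := by
        rw [div_eq_mul_inv, mul_inv]
        have hb := four_zpow_bookkeeping_frame k l j p n
        calc κ * 2 ^ (7 * p) * (4 : ℝ) ^ ((k : ℤ) - j) * (c k + c' k * |U|) *
              (U ^ 2 * U ^ 2 * (4 : ℝ) ^ (((l : ℤ) - 2) * n) * (4 : ℝ) ^ (((j : ℤ) - 2) * ((n + 1 : ℕ) : ℤ)) *
                ((2 ^ (7 * p))⁻¹ * ((4 : ℝ) ^ (p * n))⁻¹))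
            = κ * (c k + c' k * |U|) * U ^ 2 * U ^ 2 * (2 ^ (7 * p) * (2 ^ (7 * p))⁻¹) *
                (((4 : ℝ) ^ ((k : ℤ) - j) * (4 : ℝ) ^ (((l : ℤ) - 2) * n) * (4 : ℝ) ^ (((j : ℤ) - 2) * ((n + 1 : ℕ) : ℤ))) *
                  ((4 : ℝ) ^ (p * n))⁻¹) := by ring
          _ = κ * (c k + c' k * |U|) * U ^ 2 * U ^ 2 * 1 *
                ((4 : ℝ) ^ (((l : ℤ) + j - k - p - 2) * n) * (4 : ℝ) ^ (((k : ℤ) - 2) * ((n + 1 : ℕ) : ℤ)) *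
                  ((4 : ℝ) ^ (p * n) * ((4 : ℝ) ^ (p * n))⁻¹)) := by rw [mul_inv_cancel₀ h2p.ne', hb]; ring
          _ = κ * U ^ 2 * (4 : ℝ) ^ (((l : ℤ) + j - k - p - 2) * n) *
                ((c k + c' k * |U|) * U ^ 2 * (4 : ℝ) ^ (((k : ℤ) - 2) * ((n + 1 : ℕ) : ℤ))) := by
                rw [mul_inv_cancel₀ h4p.ne']; ring

/-! ## §5 The flow frame's sizes in closed form (from the history's `FlowPieceJetsAt`) -/

section Model

variable {L M : ℕ} [NeZero L] [NeZero M]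

/-- **Frame sizes from the history**: `‖Dʲ evalM K_n (q)‖ ≤ Σ_{m<n} Gfr_j·uPow j U·4^{(j−2)m}` for `j ≤ 4`, given `FlowPieceJetsAt … m` for every `m < n`
(p2's `norm_iteratedFDeriv_evalM_klFlowFrameU_le_sum` at the registered piece law). -/
theorem norm_iteratedFDeriv_evalM_klFlowFrameU_le_of_hist {β U μ : ℝ} {R : RenConsts} {n : ℕ}
    (hist : ∀ m < n, FlowPieceJetsAt L M β U μ R m) {j : ℕ} (hj : j ≤ 4) (q : Momentum) :
    ‖iteratedFDeriv ℝ j (evalM (klFlowFrameU L M β U μ n)) q‖ ≤ ∑ m ∈ range n, R.Gfr j * uPow j U * (4 : ℝ) ^ (((j : ℤ) - 2) * m) :=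
  norm_iteratedFDeriv_evalM_klFlowFrameU_le_sum (pj := fun m j => R.Gfr j * uPow j U * (4 : ℝ) ^ (((j : ℤ) - 2) * m))
    (fun m hm q => hist m hm j hj q) q

end Model

/-- `3·Σ_{m<n} 4^m + 1 ≤ 4ⁿ`. -/
theorem three_mul_sum_range_four_pow_le (n : ℕ) : 3 * ∑ m ∈ range n, (4 : ℝ) ^ m + 1 ≤ 4 ^ n := by
  induction n with
  | zero => simp
  | succ n ih => rw [sum_range_succ, pow_succ]; linarith

/-- `15·Σ_{m<n} 16^m + 1 ≤ 16ⁿ`. -/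
theorem fifteen_mul_sum_range_sixteen_pow_le (n : ℕ) : 15 * ∑ m ∈ range n, (16 : ℝ) ^ m + 1 ≤ 16 ^ n := by
  induction n with
  | zero => simp
  | succ n ih => rw [sum_range_succ, pow_succ]; linarith

/-- `3·Σ_{m<n} (1/4)^m ≤ 4 − 4·(1/4)ⁿ` (so `≤ 4`, i.e. the sum is `≤ 4/3`). -/
theorem three_mul_sum_range_quarter_pow_le (n : ℕ) : 3 * ∑ m ∈ range n, (1 / 4 : ℝ) ^ m ≤ 4 - 4 * (1 / 4) ^ n := by
  induction n with
  | zero => simp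
  | succ n ih => rw [sum_range_succ, pow_succ]; linarith

/-- `15·Σ_{m<n} (1/16)^m ≤ 16 − 16·(1/16)ⁿ` (the sum is `≤ 16/15`). -/
theorem fifteen_mul_sum_range_sixteenth_pow_le (n : ℕ) : 15 * ∑ m ∈ range n, (1 / 16 : ℝ) ^ m ≤ 16 - 16 * (1 / 16) ^ n := by
  induction n with
  | zero => simp
  | succ n ih => rw [sum_range_succ, pow_succ]; linarith

/-- The registered exponent at each order: `4^{(j−2)m}` for `j = 0, 1, 2, 3, 4` is `(1/16)^m, (1/4)^m, 1, 4^m, 16^m`. -/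
theorem four_zpow_sub_two_mul_eq (j m : ℕ) (hj : j ≤ 4) :
    (4 : ℝ) ^ (((j : ℤ) - 2) * m) =
      if j = 0 then (1 / 16 : ℝ) ^ m else if j = 1 then (1 / 4 : ℝ) ^ m else if j = 2 then 1 else if j = 3 then (4 : ℝ) ^ m else (16 : ℝ) ^ m := by
  have h4 : (4 : ℝ) ≠ 0 := by norm_num
  interval_cases j
  · simp only [CharP.cast_eq_zero, zero_sub, ↓reduceIte]
    rw [zpow_mul, show ((-2 : ℤ)) = -((2 : ℕ) : ℤ) by norm_num, zpow_neg, zpow_natCast, zpow_natCast]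
    norm_num
  · simp only [Nat.cast_one, show ((1 : ℤ) - 2) = -1 by norm_num, one_ne_zero, ↓reduceIte]
    rw [zpow_mul, zpow_neg_one, zpow_natCast, one_div]
  · simp
  · simp only [Nat.cast_ofNat, show ((3 : ℤ) - 2) = 1 by norm_num, one_mul, zpow_natCast]; simp
  · simp only [Nat.cast_ofNat, show ((4 : ℤ) - 2) = 2 by norm_num]
    rw [zpow_mul, show ((2 : ℤ)) = ((2 : ℕ) : ℤ) by norm_num, zpow_natCast, zpow_natCast, ← pow_mul]
    norm_num [pow_mul]

section Model

variable {L M : ℕ} [NeZero L] [NeZero M]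

/-- **Closed forms of the flow frame's sizes** at `K_n` from the history (`R.Gfr j ≥ 0`):
`j = 0`: `≤ (16/15)·Gfr₀·|U|`;  `j = 1`: `≤ (4/3)·Gfr₁·U²`;  `j = 2`: `≤ n·Gfr₂·U²` (the one cumulative FLAT row);
`j = 3`: `≤ (Gfr₃/3)·U²·4ⁿ`;  `j = 4`: `≤ (Gfr₄/15)·U²·16ⁿ` (the growing rows — harmless in the (C1) budget by §4). -/
theorem flowFrame_sizes_closed {β U μ : ℝ} {R : RenConsts} (hR : ∀ j, 0 ≤ R.Gfr j) {n : ℕ}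
    (hist : ∀ m < n, FlowPieceJetsAt L M β U μ R m) (q : Momentum) :
    ‖iteratedFDeriv ℝ 0 (evalM (klFlowFrameU L M β U μ n)) q‖ ≤ 16 / 15 * R.Gfr 0 * |U| ∧
    ‖iteratedFDeriv ℝ 1 (evalM (klFlowFrameU L M β U μ n)) q‖ ≤ 4 / 3 * R.Gfr 1 * U ^ 2 ∧
    ‖iteratedFDeriv ℝ 2 (evalM (klFlowFrameU L M β U μ n)) q‖ ≤ n * R.Gfr 2 * U ^ 2 ∧
    ‖iteratedFDeriv ℝ 3 (evalM (klFlowFrameU L M β U μ n)) q‖ ≤ R.Gfr 3 / 3 * U ^ 2 * 4 ^ n ∧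
    ‖iteratedFDeriv ℝ 4 (evalM (klFlowFrameU L M β U μ n)) q‖ ≤ R.Gfr 4 / 15 * U ^ 2 * 16 ^ n := by
  have h := fun j (hj : j ≤ 4) => norm_iteratedFDeriv_evalM_klFlowFrameU_le_of_hist hist hj q
  have hsum : ∀ j (hj : j ≤ 4), ∑ m ∈ range n, R.Gfr j * uPow j U * (4 : ℝ) ^ (((j : ℤ) - 2) * m) =
      R.Gfr j * uPow j U * ∑ m ∈ range n, (4 : ℝ) ^ (((j : ℤ) - 2) * m) := fun j hj => by rw [mul_sum]
  have hU0 : uPow 0 U = |U| := by simp [uPow]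
  have hU : ∀ j, 1 ≤ j → uPow j U = U ^ 2 := fun j hj => by unfold uPow; rw [if_neg (by omega)]
  refine ⟨?_, ?_, ?_, ?_, ?_⟩
  · refine (h 0 (by norm_num)).trans ?_
    rw [hsum 0 (by norm_num), hU0, sum_congr rfl fun m _ => four_zpow_sub_two_mul_eq 0 m (by norm_num)]
    simp only [↓reduceIte]
    have hs := fifteen_mul_sum_range_sixteenth_pow_le n
    have hp : 0 ≤ (1 / 16 : ℝ) ^ n := by positivity
    have hG : 0 ≤ R.Gfr 0 * |U| := mul_nonneg (hR 0) (abs_nonneg U)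
    nlinarith
  · refine (h 1 (by norm_num)).trans ?_
    rw [hsum 1 (by norm_num), hU 1 le_rfl, sum_congr rfl fun m _ => four_zpow_sub_two_mul_eq 1 m (by norm_num)]
    simp only [one_ne_zero, ↓reduceIte]
    have hs := three_mul_sum_range_quarter_pow_le n
    have hp : 0 ≤ (1 / 4 : ℝ) ^ n := by positivity
    have hG : 0 ≤ R.Gfr 1 * U ^ 2 := mul_nonneg (hR 1) (sq_nonneg U)
    nlinarith
  · refine (h 2 (by norm_num)).trans ?_
    rw [hsum 2 (by norm_num), hU 2 (by norm_num), sum_congr rfl fun m _ => four_zpow_sub_two_mul_eq 2 m (by norm_num)]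
    simp
    ring_nf; rfl
  · refine (h 3 (by norm_num)).trans ?_
    rw [hsum 3 (by norm_num), hU 3 (by norm_num), sum_congr rfl fun m _ => four_zpow_sub_two_mul_eq 3 m (by norm_num)]
    simp only [show (3 : ℕ) ≠ 0 from by norm_num, show (3 : ℕ) ≠ 1 from by norm_num, show (3 : ℕ) ≠ 2 from by norm_num, ↓reduceIte]
    have hs := three_mul_sum_range_four_pow_le n
    have hG : 0 ≤ R.Gfr 3 * U ^ 2 := mul_nonneg (hR 3) (sq_nonneg U)
    nlinarith
  · refine (h 4 (by norm_num)).trans ?_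
    rw [hsum 4 (by norm_num), hU 4 (by norm_num), sum_congr rfl fun m _ => four_zpow_sub_two_mul_eq 4 m (by norm_num)]
    simp only [show (4 : ℕ) ≠ 0 from by norm_num, show (4 : ℕ) ≠ 1 from by norm_num, show (4 : ℕ) ≠ 2 from by norm_num,
      show (4 : ℕ) ≠ 3 from by norm_num, ↓reduceIte]
    have hs := fifteen_mul_sum_range_sixteen_pow_le n
    have hG : 0 ≤ R.Gfr 4 * U ^ 2 := mul_nonneg (hR 4) (sq_nonneg U)
    nlinarith

/-- **The flat row in the regime**: `‖D² evalM K_n‖ ≤ Gfr₂·(c/log 4)` under `IsKLRegime U c (−n)` (`U²·n·log 4 ≤ c`) — `n`-uniform through the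
regime, small through `c`, NOT through `U` (the same `(c/log 4)`-currency as the cell's mixed space row). -/
theorem flowFrame_size_two_regime {β U μ c : ℝ} {R : RenConsts} (hR : ∀ j, 0 ≤ R.Gfr j) {n : ℕ}
    (hist : ∀ m < n, FlowPieceJetsAt L M β U μ R m) (hreg : IsKLRegime U c (-(n : ℤ))) (q : Momentum) :
    ‖iteratedFDeriv ℝ 2 (evalM (klFlowFrameU L M β U μ n)) q‖ ≤ R.Gfr 2 * (c / Real.log 4) := by
  have h2 := (flowFrame_sizes_closed hR hist q).2.2.1
  have hr : R.Gfr 2 * U ^ 2 * |(((-(n : ℤ)) : ℤ) : ℝ)| ≤ R.Gfr 2 * c / Real.log 4 := hreg.mul_le (hR 2)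
  have habs : |(((-(n : ℤ)) : ℤ) : ℝ)| = n := by push_cast; rw [abs_neg]; exact abs_of_nonneg (by positivity)
  rw [habs] at hr
  calc ‖iteratedFDeriv ℝ 2 (evalM (klFlowFrameU L M β U μ n)) q‖ ≤ n * R.Gfr 2 * U ^ 2 := h2
    _ = R.Gfr 2 * U ^ 2 * n := by ring
    _ ≤ R.Gfr 2 * c / Real.log 4 := hr
    _ = R.Gfr 2 * (c / Real.log 4) := by ring

end Model

end Summit.HubbardSuperconductivity.HubbardSuperconductivity.Theorems.KLRegimeSplit

end
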